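import Literature.AlgebraicGeometry.Motives.UniversalHyperplaneSectionFibreSection
import Literature.AlgebraicGeometry.HodgeTheory.HyperplaneSectionMonodromy
import Literature.AlgebraicGeometry.HodgeTheory.HypersurfaceSectionLefschetz
import Literature.AlgebraicGeometry.HodgeTheory.AndreottiFrankelAffine
import HarnessLib

/-!
# Hyperplane sections of a base-point-free linear system: the members of the universal hyperplane
# section of an AFFINE morphism `φ : X ⟶ ℙᴺ` — closed immersion, complex points, weak Lefschetz,
# and the restriction of a `φ`-invariant endomorphism

Topic `Literature/AlgebraicGeometry/HodgeTheory` (theorems only; no definitions, no named facts).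

The tree's universal hyperplane section `π : 𝒳_φ ⟶ (ℙᴺ)^*` (`Motives/UniversalHyperplaneSection`)
is defined for ANY morphism `φ : X ⟶ ℙᴺ_ℂ`; its member `Y_s = π⁻¹[s] ⟶ X` over `s = [a]` is the
preimage `φ⁻¹(H_a)` of the hyperplane `H_a = V₊(Σ aᵢ xᵢ)`, i.e. the member of the linear system
`φ^*|𝒪(1)|` (base-point free; NOT very ample unless `φ` is an immersion). The weak Lefschetz
theorem holds for such members as soon as the complement `X ∖ Y_s` is AFFINE — Lazarsfeld,
*Positivity* I, Thm. 3.1.1 and Rem. 3.1.2 (Lefschetz hyperplane theorem for an ample, not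
necessarily very ample, effective divisor: "`X − D` is affine […] so the result follows from
Andreotti–Frankel", Thm. 3.1.1 being Andreotti–Frankel / Voisin II Thm. 1.22); and `X ∖ Y_s =
φ⁻¹(ℙᴺ ∖ H_a) = φ⁻¹ D₊(Σ aᵢ xᵢ)` is affine whenever `φ` is an AFFINE morphism, in particular for
`φ` FINITE (the case of the morphism defined by the invariant sections of an ample linearised line
bundle, `Motives/NormMapInvariantMorphism`, whose general members are the smooth STABLE sections of
`X` under a finite group — Bertini for base-point-free systems, the tree's fact
`Hartshorne1977_bertini_finiteMorphism`).

* §1 `isClosedImmersion_fiberι_toX_left` — `Y_s ⟶ X` is a closed immersion (for any `φ`; the tree's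
  `UniversalHyperplaneSection.isClosedImmersion_fiberι_proj_toX_left` is the case of an embedding,
  same proof: `Y_s ⟶ 𝒳 ⟶ X × (ℙᴺ)^*` is `(Y_s ⟶ X) ≫ (slice at s)`).
* §2 `mem_range_map_fiberι_toX_iff` — the complex points of `Y_s` in `X(ℂ)` are the `P` with
  `(P, s)` in the incidence locus, i.e. (`…_iff_sum_eq_zero`, the tree's Segre dictionary
  `ProjectiveSpace.pt_lift_mem_incidenceLocus_iff`) with `Σ wᵢ aᵢ = 0` where `φ(P) = [w]`; so the
  complement of `Y_s(ℂ)` in `X(ℂ)` is the set of complex points over the open `φ⁻¹ D₊(Σ aᵢ xᵢ)`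
  (`compl_range_map_fiberι_toX_eq`).
* §3 **Weak Lefschetz for the smooth members of a base-point-free ample system**
  (`bijective_complexBettiMap_fiberι_toX_of_lt`, `injective_complexBettiMap_fiberι_toX`): for `X`
  smooth projective of dimension `n + 1`, `φ` affine and `s ∈ universalSmoothLocus N φ n`, restriction
  `Hᵏ(X(ℂ); ℂ) → Hᵏ(Y_s(ℂ); ℂ)` is bijective for `k < n` and injective for `k = n` — Andreotti–Frankel
  for the affine open `φ⁻¹ D₊(Σ aᵢ xᵢ)` (the tree's `isZero_singularHomology_setOf_pt_mem_affineOpen`)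
  and the two duality steps of `HodgeTheory/HypersurfaceSectionLefschetz`.
* §4 **Restriction of a `φ`-invariant endomorphism**: if `f : X ⟶ X` satisfies `f ≫ φ = φ`, then
  `f × 𝟙` preserves the incidence locus, so lifts to `f̃ : 𝒳_φ ⟶ 𝒳_φ` over `(ℙᴺ)^*`
  (`exists_lift_universalHyperplaneSection`; the tree's `liftOfRangeSubset` for the reduced `𝒳_φ`),
  and restricts to EVERY member: `g_s : Y_s ⟶ Y_s` with `g_s ≫ ι_s = ι_s ≫ f`
  (`exists_restrict_fiberOver`); if `f` has finite order `m` so has `g_s` (`pow_eq_one_of_restrict`).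

## References

* [Lazarsfeld2004PositivityI] R. Lazarsfeld, *Positivity in Algebraic Geometry I*, Thm. 3.1.1,
  Rem. 3.1.2 (Lefschetz hyperplane theorem for ample divisors via Andreotti–Frankel), Prop. 1.2.13.
* [VoisinHodgeII2003] C. Voisin, *Hodge Theory and Complex Algebraic Geometry II*, §1.2.2
  Thm. 1.22–1.23, §2.3.1 (members of the universal family), §3.2.2.
* [Hartshorne1977] R. Hartshorne, *Algebraic Geometry*, III Cor. 10.9 (Bertini for base-point-free
  systems), II Example 3.2.6, II Ex. 5.11.
-/

noncomputable section

open CategoryTheory CategoryTheory.Limits AlgebraicGeometry TopologicalSpace MonoidalCategory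
  CartesianMonoidalCategory
open Literature.AlgebraicGeometry.Motives Literature.AlgebraicGeometry.Motives.UniversalHyperplaneSection
open Literature.AlgebraicTopology.SingularHomology

universe u

namespace Literature.AlgebraicGeometry.HodgeTheory

attribute [local instance] MvPolynomial.gradedAlgebra

namespace FiniteMorphismSection

variable {N : ℕ} {X : SchemeOver ℂ} (φ : X ⟶ projectiveSpace N ℂ)
  (s : ComplexPoints (dualProjectiveSpace N ℂ))

/-! ### §1 The member `Y_s ⟶ X` is a closed immersion -/

/-- Every morphism to `Spec ℂ` over `ℂ` is the structure map (`Spec ℂ` is terminal over `ℂ`). [folklore] -/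
private theorem eq_toSpecOver_of_hom {Y : SchemeOver ℂ} (g : Y ⟶ specOver ℂ ℂ) : g = toSpecOver Y := by
  apply Over.OverMorphism.ext
  rw [toSpecOver_left, ← Over.w g]
  simp only [specOver, Over.mk_hom, Algebra.algebraMap_self, CommRingCat.ofHom_id, Spec.map_id]
  exact (Category.comp_id _).symm

/-- An endomorphism of `Spec ℂ` over `ℂ` is the identity. [folklore] -/
private theorem endSpecOver_eq_id (g : specOver ℂ ℂ ⟶ specOver ℂ ℂ) : g = 𝟙 _ :=
  (eq_toSpecOver_of_hom g).trans (eq_toSpecOver_of_hom (𝟙 _)).symm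

/-- `Y_s ⟶ 𝒳 ⟶ X × (ℙᴺ)^*` is `(Y_s ⟶ X) ≫ (slice at s)`. [cite: VoisinHodgeII2003, §2.3.1] -/
theorem fiberι_proj_emb_eq_sliceAt :
    fiberι (proj N φ) s ≫ emb N φ = (fiberι (proj N φ) s ≫ toX N φ) ≫ sliceAt X s := by
  apply CartesianMonoidalCategory.hom_ext
  · rw [Category.assoc, Category.assoc, sliceAt_fst, Category.comp_id]
    rfl
  · rw [Category.assoc, Category.assoc, sliceAt_snd, ← Category.assoc _ (toSpecOver X),
      eq_toSpecOver_of_hom ((fiberι _ _ ≫ toX N φ) ≫ toSpecOver X),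
      ← eq_toSpecOver_of_hom (fiberOverToSpec _ _), ← fiberι_comp]
    rfl

/-- **The member `Y_s = φ⁻¹(H_s) ⟶ X` of the universal hyperplane section of any `φ : X ⟶ ℙᴺ_ℂ` is
a closed immersion** (`Y_s ⟶ 𝒳 ⟶ X × (ℙᴺ)^*` is one and factors through the closed immersion
`X ≅ X × {s} ⟶ X × (ℙᴺ)^*`). [cite: VoisinHodgeII2003, §2.3.1] -/
theorem isClosedImmersion_fiberι_toX_left [LocallyOfFiniteType X.hom] :
    IsClosedImmersion (fiberι (proj N φ) s ≫ toX N φ).left := by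
  haveI : IsSeparated (dualProjectiveSpace N ℂ).hom := inferInstance
  haveI := isClosedImmersion_fiberι_left (proj N φ) s
  haveI : IsClosedImmersion (sliceAt X s).left := isClosedImmersion_sliceAt_left _
  haveI : IsClosedImmersion ((fiberι (proj N φ) s ≫ toX N φ).left ≫ (sliceAt X s).left) := by
    rw [← Over.comp_left, ← fiberι_proj_emb_eq_sliceAt, Over.comp_left]
    infer_instance
  exact IsClosedImmersion.of_comp_isClosedImmersion _ (sliceAt X s).left

/-- The member `Y_s ⟶ X` is a closed immersion, for `X` smooth projective. [cite: VoisinHodgeII2003, §2.3.1] -/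
theorem isClosedImmersion_fiberι_toX_left_of_isSmoothProjective {n : ℕ}
    (hX : IsSmoothProjective n X) : IsClosedImmersion (fiberι (proj N φ) s ≫ toX N φ).left :=
  haveI : LocallyOfFiniteType X.hom := locallyOfFiniteType_of_isSmoothProjective hX
  isClosedImmersion_fiberι_toX_left φ s

/-! ### §2 The complex points of the member `Y_s` -/

/-- A complex point of `𝒳` in `X × (ℙᴺ)^*` is the pair of its two projections. [cite: VoisinHodgeII2003, §3.2.2] -/
theorem map_emb_eq_lift (y : ComplexPoints (universalHyperplaneSection N φ)) :
    AlgPoints.map (emb N φ) y =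
      CartesianMonoidalCategory.lift (AlgPoints.map (toX N φ) y) (AlgPoints.map (proj N φ) y) := by
  apply CartesianMonoidalCategory.hom_ext
  · rw [CartesianMonoidalCategory.lift_fst, AlgPoints.map_apply, AlgPoints.map_apply, Category.assoc]
    rfl
  · rw [CartesianMonoidalCategory.lift_snd, AlgPoints.map_apply, AlgPoints.map_apply, Category.assoc]
    rfl

/-- The points of the member lie over `s`. [cite: VoisinHodgeII2003, §3.2.2] -/
theorem map_proj_map_fiberι (z : ComplexPoints (fiberOver (proj N φ) s)) :
    AlgPoints.map (proj N φ) (AlgPoints.map (fiberι (proj N φ) s) z) = s := by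
  rw [← AlgPoints.map_comp_apply, fiberι_comp, AlgPoints.map_apply, ← Category.assoc,
    endSpecOver_eq_id (z ≫ fiberOverToSpec _ _), Category.id_comp]

/-- **The complex points of `Y_s` in `X(ℂ)`**: `P` lies on `Y_s` iff `(P, s)` lies in the incidence
locus `{(x, a) | Σ aᵢ xᵢ(x) = 0}`. [cite: VoisinHodgeII2003, §3.2.2 and §2.3.1] -/
theorem mem_range_map_fiberι_toX_iff (P : ComplexPoints X) :
    P ∈ Set.range (AlgPoints.map (L := ℂ) (fiberι (proj N φ) s ≫ toX N φ)) ↔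
      AlgPoints.pt (CartesianMonoidalCategory.lift P s :
          ComplexPoints (X ⊗ dualProjectiveSpace N ℂ)) ∈
        (incidenceLocus N φ : Set (X ⊗ dualProjectiveSpace N ℂ).left) := by
  constructor
  · rintro ⟨z, rfl⟩
    have h : CartesianMonoidalCategory.lift
        (AlgPoints.map (fiberι (proj N φ) s ≫ toX N φ) z) s =
        AlgPoints.map (emb N φ) (AlgPoints.map (fiberι (proj N φ) s) z) := by
      rw [map_emb_eq_lift, map_proj_map_fiberι, AlgPoints.map_comp_apply]
    rw [h, AlgPoints.pt_map, ← range_emb]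
    exact ⟨_, rfl⟩
  · intro h
    rw [← range_emb] at h
    set y := AlgPoints.liftClosed (emb N φ) (CartesianMonoidalCategory.lift P s) h with hy_def
    have hy : AlgPoints.map (emb N φ) y = CartesianMonoidalCategory.lift P s :=
      AlgPoints.map_liftClosed _ _ h
    have hproj : AlgPoints.map (proj N φ) y = s := by
      change AlgPoints.map (emb N φ ≫ CartesianMonoidalCategory.snd _ _) y = s
      rw [AlgPoints.map_comp_apply, hy, AlgPoints.map_apply, CartesianMonoidalCategory.lift_snd]
    have htoX : AlgPoints.map (toX N φ) y = P := by
      change AlgPoints.map (emb N φ ≫ CartesianMonoidalCategory.fst _ _) y = P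
      rw [AlgPoints.map_comp_apply, hy, AlgPoints.map_apply, CartesianMonoidalCategory.lift_fst]
    -- lift `y` to the fibre `Y_s = 𝒳 ×_{(ℙᴺ)^*} {s}`
    have w : y.left ≫ (proj N φ).left = 𝟙 _ ≫ s.left := by
      rw [Category.id_comp, ← Over.comp_left]
      exact congrArg CommaMorphism.left hproj
    refine ⟨Over.homMk (pullback.lift y.left (𝟙 _) w) ?_, ?_⟩
    · change pullback.lift y.left (𝟙 _) w ≫ (pullback.fst _ _ ≫ (universalHyperplaneSection N φ).hom) = _
      rw [pullback.lift_fst_assoc]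
      exact Over.w y
    · rw [AlgPoints.map_comp_apply, ← htoX]
      congr 1
      apply Over.OverMorphism.ext
      change pullback.lift y.left (𝟙 _) w ≫ pullback.fst _ _ = y.left
      exact pullback.lift_fst _ _ _

/-- **In coordinates**: for `φ(P) = [w]` and `s = [a]`, `P ∈ Y_s(ℂ)` iff `Σᵢ wᵢ aᵢ = 0`.
[cite: VoisinHodgeII2003, §3.2.2] [cite: Hartshorne1977, II Ex. 5.11] -/
theorem mem_range_map_fiberι_toX_iff_sum_eq_zero (P : ComplexPoints X) {w : Fin (N + 1) → ℂ}
    (hw : w ≠ 0) (hP : AlgPoints.map φ P = ProjectiveSpace.pointOfVec ℂ w hw)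
    {a : Fin (N + 1) → ℂ} (ha : a ≠ 0) :
    P ∈ Set.range (AlgPoints.map (L := ℂ)
        (fiberι (proj N φ) (ProjectiveSpace.pointOfVec ℂ a ha) ≫ toX N φ)) ↔ ∑ i, w i * a i = 0 := by
  rw [mem_range_map_fiberι_toX_iff, ProjectiveSpace.pt_lift_mem_incidenceLocus_iff φ P hw hP ha]

/-- **The complement of `Y_{[a]}(ℂ)` in `X(ℂ)` is the set of complex points over the open
`φ⁻¹ D₊(ℓ_a)`**, `ℓ_a = Σ aᵢ xᵢ`. [cite: VoisinHodgeII2003, §2.3.1] -/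
theorem compl_range_map_fiberι_toX_eq {a : Fin (N + 1) → ℂ} (ha : a ≠ 0) :
    (Set.range (AlgPoints.map (L := ℂ)
        (fiberι (proj N φ) (ProjectiveSpace.pointOfVec ℂ a ha) ≫ toX N φ)))ᶜ =
      {P : ComplexPoints X | P.pt ∈ (φ.left ⁻¹ᵁ Proj.basicOpen
        (MvPolynomial.homogeneousSubmodule (Fin (N + 1)) ℂ) (linForm N a) : Set X.left)} := by
  ext P
  obtain ⟨w, hw, hP⟩ := ProjectiveSpace.exists_eq_pointOfVec (AlgPoints.map φ P)
  rw [Set.mem_compl_iff, mem_range_map_fiberι_toX_iff_sum_eq_zero φ P hw hP ha, Set.mem_setOf_eq]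
  change _ ↔ φ.left.base P.pt ∈ Proj.basicOpen _ (linForm N a)
  rw [← AlgPoints.pt_map, hP,
    ProjectiveSpace.pt_pointOfVec_mem_basicOpen_iff w hw one_pos (linForm_mem N a)]
  simp [linForm, mul_comm]

/-! ### §3 Weak Lefschetz for the smooth members of a base-point-free ample system -/

/-- **Andreotti–Frankel for the complement of a member**: for `X` smooth of dimension `n + 1` and
`φ` an AFFINE morphism, `X(ℂ) ∖ Y_s(ℂ)` — the complex points over the affine open `φ⁻¹ D₊(ℓ_a)` —
has no homology in degrees `≥ n + 2` (Voisin II Thm. 1.22; Lazarsfeld 3.1.1/3.1.2: "`X − D` is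
affine"). [cite: Lazarsfeld2004PositivityI, Thm. 3.1.1 and Rem. 3.1.2] [cite: VoisinHodgeII2003, §1.2.2 Thm. 1.22] -/
theorem isZero_singularHomology_compl_range {n : ℕ} (hX : IsSmoothProjective (n + 1) X)
    [IsAffineHom φ.left] {j : ℕ} (hj : n + 2 ≤ j) :
    IsZero (singularHomology ℂ ℂ
      ↥(Set.range (AlgPoints.map (L := ℂ) (fiberι (proj N φ) s ≫ toX N φ)))ᶜ j) := by
  obtain ⟨a, ha, rfl⟩ := ProjectiveSpace.exists_eq_pointOfVec s
  haveI := hX.smoothOfRelativeDimension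
  haveI : LocallyOfFiniteType X.hom := locallyOfFiniteType_of_isSmoothProjective hX
  haveI : @IsAffineHom X.left (Proj (MvPolynomial.homogeneousSubmodule (Fin (N + 1)) ℂ)) φ.left :=
    ‹IsAffineHom φ.left›
  rw [compl_range_map_fiberι_toX_eq φ ha]
  exact AffineCoordinates.isZero_singularHomology_setOf_pt_mem_affineOpen X
    (φ.left ⁻¹ᵁ Proj.basicOpen (MvPolynomial.homogeneousSubmodule (Fin (N + 1)) ℂ) (linForm N a))
    ((Proj.isAffineOpen_basicOpen _ _ (linForm_mem N a) one_pos).preimage φ.left) (by omega)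

/-- **Weak Lefschetz for base-point-free ample systems, bijective range** (Lazarsfeld Thm. 3.1.1 /
Voisin II Thm. 1.23 on the universal family of an AFFINE `φ : X ⟶ ℙᴺ`): for `X` smooth projective of
dimension `n + 1` and a member `Y_s` that is smooth projective of dimension `n`
(`s ∈ universalSmoothLocus N φ n`), restriction `Hᵏ(X(ℂ); ℂ) → Hᵏ(Y_s(ℂ); ℂ)` is bijective for
`k < n`. [cite: Lazarsfeld2004PositivityI, Thm. 3.1.1 and Rem. 3.1.2] [cite: VoisinHodgeII2003, §1.2.2 Thm. 1.23] -/
theorem bijective_complexBettiMap_fiberι_toX_of_lt {n : ℕ} (hX : IsSmoothProjective (n + 1) X)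
    [IsAffineHom φ.left] (hs : s ∈ universalSmoothLocus N φ n) {k : ℕ} (hk : k < n) :
    Function.Bijective (complexBetti.map (fiberι (proj N φ) s ≫ toX N φ) k) := by
  have hY : IsSmoothProjective n (fiberOver (proj N φ) s) := hs
  haveI := isClosedImmersion_fiberι_toX_left_of_isSmoothProjective φ s hX
  exact ⟨injective_complexBettiMap_of_isZero_singularHomology_compl_range hX hY _
      (j := 2 * (n + 1) - k) (by omega) (isZero_singularHomology_compl_range φ s hX (by omega)),
    surjective_complexBettiMap_of_isZero_singularHomology_compl_range hX hY _
      (j := 2 * (n + 1) - 1 - k) (by omega) (isZero_singularHomology_compl_range φ s hX (by omega))⟩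

/-- **Weak Lefschetz for base-point-free ample systems, injectivity in the middle degree**: with
notation as above, `Hⁿ(X(ℂ); ℂ) → Hⁿ(Y_s(ℂ); ℂ)` is injective (indeed for all `k ≤ n`).
[cite: Lazarsfeld2004PositivityI, Thm. 3.1.1 and Rem. 3.1.2] [cite: VoisinHodgeII2003, §1.2.2 Thm. 1.23] -/
theorem injective_complexBettiMap_fiberι_toX {n : ℕ} (hX : IsSmoothProjective (n + 1) X)
    [IsAffineHom φ.left] (hs : s ∈ universalSmoothLocus N φ n) {k : ℕ} (hk : k ≤ n) :
    Function.Injective (complexBetti.map (fiberι (proj N φ) s ≫ toX N φ) k) := by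
  have hY : IsSmoothProjective n (fiberOver (proj N φ) s) := hs
  haveI := isClosedImmersion_fiberι_toX_left_of_isSmoothProjective φ s hX
  exact injective_complexBettiMap_of_isZero_singularHomology_compl_range hX hY _
    (j := 2 * (n + 1) - k) (by omega) (isZero_singularHomology_compl_range φ s hX (by omega))

/-! ### §4 Restriction of a `φ`-invariant endomorphism to the members -/

variable (f : X ⟶ X)

/-- `f × 𝟙` preserves the incidence locus of `φ` when `f ≫ φ = φ` (the locus is a preimage under
`(φ × 𝟙) ≫ Segre`, and `(f × 𝟙) ≫ (φ × 𝟙) = (f ≫ φ) × 𝟙`). [cite: VoisinHodgeII2003, §3.2.2] -/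
theorem whiskerRight_mem_incidenceLocus_iff (hf : f ≫ φ = φ) (x : ↥(X ⊗ dualProjectiveSpace N ℂ).left) :
    (f ▷ dualProjectiveSpace N ℂ).left.base x ∈
        (incidenceLocus N φ : Set (X ⊗ dualProjectiveSpace N ℂ).left) ↔
      x ∈ (incidenceLocus N φ : Set (X ⊗ dualProjectiveSpace N ℂ).left) := by
  have h : (f ▷ dualProjectiveSpace N ℂ) ≫ toSegre N φ = toSegre N φ := by
    rw [toSegre, ← Category.assoc, ← MonoidalCategory.comp_whiskerRight, hf]
  change (toSegre N φ).left.base ((f ▷ dualProjectiveSpace N ℂ).left.base x) ∈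
      (incidenceHyperplane N ℂ : Set (projectiveSpace (N * N + N + N) ℂ).left) ↔
    (toSegre N φ).left.base x ∈ (incidenceHyperplane N ℂ : Set (projectiveSpace (N * N + N + N) ℂ).left)
  have hx : (toSegre N φ).left ((f ▷ dualProjectiveSpace N ℂ).left x) = (toSegre N φ).left x := by
    rw [← Scheme.Hom.comp_apply, ← Over.comp_left, h]
  rw [hx]

/-- **A `φ`-invariant endomorphism lifts to the universal hyperplane section**: if `f ≫ φ = φ`
there is `f̃ : 𝒳_φ ⟶ 𝒳_φ` with `f̃ ≫ emb = emb ≫ (f × 𝟙)` (the reduced `𝒳_φ` maps into the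
incidence locus, which `f × 𝟙` preserves; the tree's `liftOfRangeSubset`). [cite: VoisinHodgeII2003, §3.2.2] [cite: Hartshorne1977, II Example 3.2.6] -/
theorem exists_lift_universalHyperplaneSection (hf : f ≫ φ = φ) :
    ∃ f' : universalHyperplaneSection N φ ⟶ universalHyperplaneSection N φ,
      f' ≫ emb N φ = emb N φ ≫ (f ▷ dualProjectiveSpace N ℂ) := by
  haveI : IsReduced (universalHyperplaneSection N φ).left :=
    isReduced_universalHyperplaneSection_left N φ
  have hrange : Set.range ((emb N φ).left ≫ (f ▷ dualProjectiveSpace N ℂ).left) ⊆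
      Set.range (emb N φ).left := by
    rintro _ ⟨y, rfl⟩
    rw [range_emb]
    change (f ▷ dualProjectiveSpace N ℂ).left.base ((emb N φ).left.base y) ∈
      (incidenceLocus N φ : Set (X ⊗ dualProjectiveSpace N ℂ).left)
    exact (whiskerRight_mem_incidenceLocus_iff φ f hf _).2 (by rw [← range_emb]; exact ⟨y, rfl⟩)
  refine ⟨Over.homMk (liftOfRangeSubset (emb N φ).left
      ((emb N φ).left ≫ (f ▷ dualProjectiveSpace N ℂ).left) hrange) ?_, ?_⟩
  · change liftOfRangeSubset _ _ hrange ≫ ((emb N φ).left ≫ (X ⊗ dualProjectiveSpace N ℂ).hom) =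
      (emb N φ).left ≫ (X ⊗ dualProjectiveSpace N ℂ).hom
    rw [liftOfRangeSubset_comp_assoc, Category.assoc, Over.w]
  · apply Over.OverMorphism.ext
    rw [Over.comp_left, Over.comp_left]
    exact liftOfRangeSubset_comp _ _ hrange

/-- **A `φ`-invariant endomorphism restricts to every member of the universal hyperplane section**:
if `f ≫ φ = φ` then for every `s` there is `g_s : Y_s ⟶ Y_s` with `g_s ≫ ι_s = ι_s ≫ f`, where
`ι_s : Y_s ⟶ X` (so the members `φ⁻¹(H)` are `f`-stable). [cite: VoisinHodgeII2003, §3.2.2 and §2.3.1] -/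
theorem exists_restrict_fiberOver (hf : f ≫ φ = φ) :
    ∃ g : fiberOver (proj N φ) s ⟶ fiberOver (proj N φ) s,
      g ≫ (fiberι (proj N φ) s ≫ toX N φ) = (fiberι (proj N φ) s ≫ toX N φ) ≫ f := by
  obtain ⟨f', hf'⟩ := exists_lift_universalHyperplaneSection φ f hf
  have hproj : f' ≫ proj N φ = proj N φ := by
    change f' ≫ (emb N φ ≫ CartesianMonoidalCategory.snd _ _) =
      emb N φ ≫ CartesianMonoidalCategory.snd _ _
    rw [← Category.assoc, hf', Category.assoc, whiskerRight_snd]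
  have htoX : f' ≫ toX N φ = toX N φ ≫ f := by
    change f' ≫ (emb N φ ≫ CartesianMonoidalCategory.fst _ _) =
      (emb N φ ≫ CartesianMonoidalCategory.fst _ _) ≫ f
    rw [← Category.assoc, hf', Category.assoc, whiskerRight_fst, Category.assoc]
  have w : (pullback.fst (proj N φ).left s.left ≫ f'.left) ≫ (proj N φ).left =
      pullback.snd (proj N φ).left s.left ≫ s.left := by
    rw [Category.assoc, ← Over.comp_left, hproj]
    exact pullback.condition
  refine ⟨Over.homMk (pullback.lift (pullback.fst _ _ ≫ f'.left) (pullback.snd _ _) w) ?_, ?_⟩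
  · change pullback.lift _ _ w ≫ (pullback.fst _ _ ≫ (universalHyperplaneSection N φ).hom) =
      pullback.fst _ _ ≫ (universalHyperplaneSection N φ).hom
    rw [pullback.lift_fst_assoc, Category.assoc, Over.w f']
  · apply Over.OverMorphism.ext
    change pullback.lift _ _ w ≫ (pullback.fst _ _ ≫ (toX N φ).left) =
      (pullback.fst _ _ ≫ (toX N φ).left) ≫ f.left
    rw [pullback.lift_fst_assoc, Category.assoc, ← Over.comp_left, htoX, Over.comp_left]
    exact (Category.assoc _ _ _).symm

/-- Powers of an endomorphism restricted along `ι : Y ⟶ X`: `g ≫ ι = ι ≫ f` implies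
`gᵐ ≫ ι = ι ≫ fᵐ`. [cite: VoisinHodgeII2003, §2.3.1] -/
theorem pow_comp_eq_comp_pow {Y : SchemeOver ℂ} (ι : Y ⟶ X) (g : Y ⟶ Y) (h : g ≫ ι = ι ≫ f)
    (m : ℕ) : (End.of g ^ m : End Y) ≫ ι = ι ≫ (End.of f ^ m : End X) := by
  induction m with
  | zero => rw [pow_zero, pow_zero, End.one_def, End.one_def, Category.id_comp, Category.comp_id]
  | succ m ih =>
    rw [pow_succ, pow_succ, End.mul_def, End.mul_def, Category.assoc, ih, ← Category.assoc,
      show (End.of g : Y ⟶ Y) = g from rfl, h, Category.assoc]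

/-- **The restriction of an automorphism of finite order has finite order**: if `g ≫ ι = ι ≫ f`
with `ι : Y ⟶ X` a closed immersion (a monomorphism) and `fᵐ = 1`, then `gᵐ = 1`.
[cite: VoisinHodgeII2003, §2.3.1] -/
theorem pow_eq_one_of_restrict {Y : SchemeOver ℂ} (ι : Y ⟶ X) [Mono ι.left] (g : Y ⟶ Y)
    (h : g ≫ ι = ι ≫ f) {m : ℕ} (hfm : End.of f ^ m = 1) : End.of g ^ m = 1 := by
  haveI : Mono ι := (Over.forget _).mono_of_mono_map ‹Mono ι.left›
  have key := pow_comp_eq_comp_pow f ι g h m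
  rw [hfm, End.one_def, Category.comp_id] at key
  rw [End.one_def]
  exact (cancel_mono ι).1 (key.trans (Category.id_comp ι).symm)

/-- **Package for the smooth members**: for `φ : X ⟶ ℙᴺ` and `f : X ⟶ X` of finite order `m` with
`f ≫ φ = φ`, every member `Y_s` carries `g_s : Y_s ⟶ Y_s` with `g_s ≫ ι_s = ι_s ≫ f` and `g_sᵐ = 1`
(here for `X` locally of finite type, so that `ι_s` is a closed immersion). [cite: VoisinHodgeII2003, §2.3.1 and §3.2.2] -/
theorem exists_restrict_fiberOver_pow_eq_one [LocallyOfFiniteType X.hom] (hf : f ≫ φ = φ) {m : ℕ}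
    (hfm : End.of f ^ m = 1) :
    ∃ g : fiberOver (proj N φ) s ⟶ fiberOver (proj N φ) s,
      g ≫ (fiberι (proj N φ) s ≫ toX N φ) = (fiberι (proj N φ) s ≫ toX N φ) ≫ f ∧
        End.of g ^ m = 1 := by
  obtain ⟨g, hg⟩ := exists_restrict_fiberOver φ s f hf
  haveI := isClosedImmersion_fiberι_toX_left φ s
  exact ⟨g, hg, pow_eq_one_of_restrict f _ g hg hfm⟩

end FiniteMorphismSection

end Literature.AlgebraicGeometry.HodgeTheory

end
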